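import Summits.AnomalousDissipation.AnomalousDissipation.Theses.TaylorCertificates

/-!
# Sketch — crux-ideate `stmt-AnomalousDissipation-14183` (`TaylorCertificates.KolmogorovFloorEnsembleCeiling`,
# rank 7), opening round, ideator 1 — card `skew-oscillatory-ray-audit`

The crux is the SAME-FORCE coupling of the Kolmogorov-class floor (#2, `KolmogorovFloor`) and the ensemble
ceiling (#4, `EnsembleCeiling`). This file types what the card needs and proves its logic:

* §A  per-force halves: `FloorClassAtFor β f` / `FloorKillAtFor β f` (copied verbatim from
      `Cruxes/KolmogorovFloor/SketchIdeator3.lean`, ideator 3 of crux 14030, so that kills proved for #2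
      transfer literally), and the new `CeilClassFor f` / `CeilKillFor f`.
* §B  `kfec_iff_sameForce` (PROVED): the crux IS the intersection question —
      `KolmogorovFloorEnsembleCeiling ↔ ∃ f admissible, FloorClassAtFor (3/4) f ∧ CeilClassFor f`.
* §C  the TWO-ADVERSARY PINCER (PROVED, first lemma of the card): to refute the crux it suffices to kill,
      for every admissible force, EITHER half — `not_kfec_of_pincer`; corollaries `not_kfec_of_floorKills`
      (inheritance from ¬#2) and `kfec_witness_outside` (any witness lies outside every killed class).
* §D  the audited classes: `IsAxisSupportedPoly` (all Fourier modes on coordinate axes: the class of BOTH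
      ensemble-ceiling candidate forces on record, f_GP and f₁₂₃, and of every force the ceiling's
      frustration test favours), `IsTrigPolyForce`; the targets `AxisSupportedFloorKill`, `PolyFloorKill`
      that the card's kit numerics (j012040 smoke, j012153, j012156) support, typed as `Prop`s (no sorry).

`lean check` target: rc 0, 0 sorries.
-/

noncomputable section

set_option linter.dupNamespace false

open MeasureTheory UnitAddTorus
open scoped InnerProductSpace ENNReal BigOperators

namespace Summit.AnomalousDissipation.AnomalousDissipation.Cruxes.KolmogorovFloorEnsembleCeiling.Ideator1

open Literature.Analysis.FunctionSpaces Literature.Analysis.FluidPDE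
open Summit.AnomalousDissipation.AnomalousDissipation.Theses.TaylorCertificates

local notation "𝕋³" => UnitAddTorus (Fin 3)
local notation "E³" => EuclideanSpace ℝ (Fin 3)
local notation "L2T" => Lp (EuclideanSpace ℝ (Fin 3)) 2 (volume : Measure (UnitAddTorus (Fin 3)))

/-! ## §A  Per-force halves -/

/-- The band-limited FLOOR clause of resolution exponent `β` for ONE force `f` (verbatim the body of the route
decl `KolmogorovFloor` after `∃ f, admissible ∧`, with `3/4 ↦ β`; copied from SketchIdeator3 of crux 14030). -/
def FloorClassAtFor (β : ℝ) (f : 𝕋³ → E³) : Prop :=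
  ∃ (ε₀ C Θ ν₀ : ℝ), 0 < ε₀ ∧ 0 < ν₀ ∧ ∀ ν : ℝ, 0 < ν → ν < ν₀ →
    ∃ (N : ℕ) (Φ₁ : Torus.CylindricalTest (Fin 3)) (θ₁ : ℝ), (N : ℝ) ≤ C * ν ^ (-β) ∧
    (∀ i, Torus.fourierTruncate N (Φ₁.g i) = Φ₁.g i) ∧ -Θ ≤ θ₁ ∧ θ₁ ≤ 0 ∧
    ∀ u : Torus.energySpace (Fin 3),
      let uf : 𝕋³ → E³ := ((u : L2T) : 𝕋³ → E³);
      let D : ℝ := ν * (Torus.eGradNormSq uf).toReal;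
      let P : ℝ := Torus.pairing (u : L2T) f - D;
      Torus.eGradNormSq uf ≠ ⊤ → ‖u‖ ^ 2 ≤ 16 * (∫ x, ‖f x‖ ^ 2) / ν ^ 2 →
      ε₀ ≤ D + Torus.nsGeneratorPairing ν f u (Φ₁.grad u) + 2 * θ₁ * P

/-- Kill shape of the floor for the class `β` and the force `f` (quantifier order of the crux: constants, then a
small `ν`, then — after the certificate is revealed — a violating finite-enstrophy state of the Leray ball). -/
def FloorKillAtFor (β : ℝ) (f : 𝕋³ → E³) : Prop :=
  ∀ (ε₀ C Θ ν₀ : ℝ), 0 < ε₀ → 0 < ν₀ → ∃ ν : ℝ, 0 < ν ∧ ν < ν₀ ∧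
    ∀ (N : ℕ) (Φ₁ : Torus.CylindricalTest (Fin 3)) (θ₁ : ℝ), (N : ℝ) ≤ C * ν ^ (-β) →
    (∀ i, Torus.fourierTruncate N (Φ₁.g i) = Φ₁.g i) → -Θ ≤ θ₁ → θ₁ ≤ 0 →
    ∃ u : Torus.energySpace (Fin 3),
      let uf : 𝕋³ → E³ := ((u : L2T) : 𝕋³ → E³);
      let D : ℝ := ν * (Torus.eGradNormSq uf).toReal;
      let P : ℝ := Torus.pairing (u : L2T) f - D;
      Torus.eGradNormSq uf ≠ ⊤ ∧ ‖u‖ ^ 2 ≤ 16 * (∫ x, ‖f x‖ ^ 2) / ν ^ 2 ∧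
      D + Torus.nsGeneratorPairing ν f u (Φ₁.grad u) + 2 * θ₁ * P < ε₀

/-- Glue (pure logic), per class and force (SketchIdeator3 of 14030). -/
theorem not_floorClassAtFor_of_kill {β : ℝ} {f : 𝕋³ → E³} (hK : FloorKillAtFor β f) :
    ¬ FloorClassAtFor β f := by
  rintro ⟨ε₀, C, Θ, ν₀, hε₀, hν₀, h⟩
  obtain ⟨ν, hν, hνν₀, hkill⟩ := hK ε₀ C Θ ν₀ hε₀ hν₀
  obtain ⟨N, Φ₁, θ₁, hN, hΦ₁, hθ₁, hθ₁', hu⟩ := h ν hν hνν₀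
  obtain ⟨u, hfin, hball, hlt⟩ := hkill N Φ₁ θ₁ hN hΦ₁ hθ₁ hθ₁'
  exact absurd (hu u hfin hball) (not_le.mpr hlt)

/-- The ENSEMBLE CEILING clause for ONE force `f` (verbatim the ceiling half of the crux / of the target `X`). -/
def CeilClassFor (f : 𝕋³ → E³) : Prop :=
  ∃ (E ν₀ : ℝ), 0 < ν₀ ∧ ∀ ν : ℝ, 0 < ν → ν < ν₀ →
    ∀ μ : Measure (Torus.energySpace (Fin 3)), Torus.IsStationaryStatisticalSolution ν f μ →
      Integrable (fun v : Torus.energySpace (Fin 3) => ‖v‖ ^ 2) μ → Torus.ensembleEnergy μ ≤ E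

/-- Kill shape of the ceiling for ONE force: FAT stationary statistics (integrable energy above any prescribed
bound) at arbitrarily small viscosity — e.g. the Dirac mass of a fat steady state (Marchioro barrier, the landed
`EnsembleCeiling/Negative/*` classes, the sheltered fat-line branches of `Cruxes/FloorCertificate/Ideas/shear-sheltering-dichotomy.md`). -/
def CeilKillFor (f : 𝕋³ → E³) : Prop :=
  ∀ (E ν₀ : ℝ), 0 < ν₀ → ∃ ν : ℝ, 0 < ν ∧ ν < ν₀ ∧
    ∃ μ : Measure (Torus.energySpace (Fin 3)), Torus.IsStationaryStatisticalSolution ν f μ ∧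
      Integrable (fun v : Torus.energySpace (Fin 3) => ‖v‖ ^ 2) μ ∧ E < Torus.ensembleEnergy μ

theorem not_ceilClassFor_of_kill {f : 𝕋³ → E³} (hK : CeilKillFor f) : ¬ CeilClassFor f := by
  rintro ⟨E, ν₀, hν₀, h⟩
  obtain ⟨ν, hν, hνν₀, μ, hμ, hint, hlt⟩ := hK E ν₀ hν₀
  exact absurd (h ν hν hνν₀ μ hμ hint) (not_le.mpr hlt)

/-! ## §B  The crux is the intersection question (same force, both halves) -/

theorem kfec_imp_sameForce (h : KolmogorovFloorEnsembleCeiling) :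
    ∃ f : 𝕋³ → E³, Torus.IsSmooth f ∧ Torus.IsDivFree f ∧ Torus.HasZeroMean f ∧
      FloorClassAtFor (3 / 4) f ∧ CeilClassFor f := by
  obtain ⟨f, hfs, hfd, hfz, ε₀, C, Θ, E, ν₀, hε₀, hν₀, h⟩ := h
  exact ⟨f, hfs, hfd, hfz, ⟨ε₀, C, Θ, ν₀, hε₀, hν₀, fun ν hν hνν₀ => (h ν hν hνν₀).1⟩,
    ⟨E, ν₀, hν₀, fun ν hν hνν₀ => (h ν hν hνν₀).2⟩⟩

theorem kfec_of_sameForce {f : 𝕋³ → E³} (hfs : Torus.IsSmooth f) (hfd : Torus.IsDivFree f)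
    (hfz : Torus.HasZeroMean f) (hF : FloorClassAtFor (3 / 4) f) (hC : CeilClassFor f) :
    KolmogorovFloorEnsembleCeiling := by
  obtain ⟨ε₀, C, Θ, ν₀, hε₀, hν₀, h⟩ := hF
  obtain ⟨E, ν₁, hν₁, h'⟩ := hC
  refine ⟨f, hfs, hfd, hfz, ε₀, C, Θ, E, min ν₀ ν₁, hε₀, lt_min hν₀ hν₁, fun ν hν hνlt => ⟨?_, ?_⟩⟩
  · exact h ν hν (lt_of_lt_of_le hνlt (min_le_left _ _))
  · exact h' ν hν (lt_of_lt_of_le hνlt (min_le_right _ _))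

/-- **The crux is exactly "one force in both witness classes".** -/
theorem kfec_iff_sameForce :
    KolmogorovFloorEnsembleCeiling ↔ ∃ f : 𝕋³ → E³, Torus.IsSmooth f ∧ Torus.IsDivFree f ∧
      Torus.HasZeroMean f ∧ FloorClassAtFor (3 / 4) f ∧ CeilClassFor f :=
  ⟨kfec_imp_sameForce, fun ⟨_, hfs, hfd, hfz, hF, hC⟩ => kfec_of_sameForce hfs hfd hfz hF hC⟩

/-! ## §C  The two-adversary pincer (first lemma of the card) -/

/-- **Pincer.** If for every admissible force the adversary kills EITHER the Kolmogorov-class floor (dressed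
laminar ray, quiet-point beat, …) OR the ensemble ceiling (a fat stationary statistical solution), the crux is
false. For #7 the refuter may choose per force; the card's point is WHERE each adversary is available. -/
theorem not_kfec_of_pincer
    (hP : ∀ f : 𝕋³ → E³, Torus.IsSmooth f → Torus.IsDivFree f → Torus.HasZeroMean f →
      FloorKillAtFor (3 / 4) f ∨ CeilKillFor f) :
    ¬ KolmogorovFloorEnsembleCeiling := by
  intro h
  obtain ⟨f, hfs, hfd, hfz, hF, hC⟩ := kfec_imp_sameForce h
  rcases hP f hfs hfd hfz with hk | hk
  · exact not_floorClassAtFor_of_kill hk hF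
  · exact not_ceilClassFor_of_kill hk hC

/-- Pincer, negation form — absorbs the LANDED per-class refutations directly: the ceiling-side
`Theorems/EnsembleCeiling/Negative/*` lemmas (`not_ceiling_of_singleShell_eulerSteady`,
`not_ceiling_of_orthogonalClass`, `not_ceiling_cellular`, single-mode) conclude literally `¬ CeilClassFor f`
for their forces, and a landed dressed-ray lemma would conclude `¬ FloorClassAtFor (3/4) f`. -/
theorem not_kfec_of_pincer'
    (hP : ∀ f : 𝕋³ → E³, Torus.IsSmooth f → Torus.IsDivFree f → Torus.HasZeroMean f →
      ¬ FloorClassAtFor (3 / 4) f ∨ ¬ CeilClassFor f) :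
    ¬ KolmogorovFloorEnsembleCeiling := by
  intro h
  obtain ⟨f, hfs, hfd, hfz, hF, hC⟩ := kfec_imp_sameForce h
  rcases hP f hfs hfd hfz with hk | hk
  · exact hk hF
  · exact hk hC

/-- Inheritance from ¬#2: a Kolmogorov-class kill for every admissible force refutes #7 (one line). -/
theorem not_kfec_of_floorKills
    (hK : ∀ f : 𝕋³ → E³, Torus.IsSmooth f → Torus.IsDivFree f → Torus.HasZeroMean f →
      FloorKillAtFor (3 / 4) f) :
    ¬ KolmogorovFloorEnsembleCeiling :=
  not_kfec_of_pincer fun f a b c => Or.inl (hK f a b c)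

/-- Any witness of the crux lies OUTSIDE every force class on which either adversary is available. -/
theorem kfec_witness_outside {Killed : (𝕋³ → E³) → Prop}
    (hKill : ∀ f : 𝕋³ → E³, Torus.IsSmooth f → Torus.IsDivFree f → Torus.HasZeroMean f → Killed f →
      FloorKillAtFor (3 / 4) f ∨ CeilKillFor f)
    (h : KolmogorovFloorEnsembleCeiling) :
    ∃ f : 𝕋³ → E³, Torus.IsSmooth f ∧ Torus.IsDivFree f ∧ Torus.HasZeroMean f ∧
      FloorClassAtFor (3 / 4) f ∧ CeilClassFor f ∧ ¬ Killed f := by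
  obtain ⟨f, hfs, hfd, hfz, hF, hC⟩ := kfec_imp_sameForce h
  refine ⟨f, hfs, hfd, hfz, hF, hC, fun hk => ?_⟩
  rcases hKill f hfs hfd hfz hk with h1 | h1
  · exact not_floorClassAtFor_of_kill h1 hF
  · exact not_ceilClassFor_of_kill h1 hC

/-! ## §D  The audited classes and the targets the numerics support -/

/-- `f` is a real vector trigonometric polynomial (finitely many Fourier modes). -/
def IsTrigPolyForce (f : 𝕋³ → E³) : Prop :=
  ∃ (S : Finset (Fin 3 → ℤ)) (c : (Fin 3 → ℤ) → EuclideanSpace ℂ (Fin 3)), f = Torus.realTrigPoly S c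

/-- `f` is a real vector trigonometric polynomial all of whose frequencies lie on the COORDINATE AXES
(e.g. `f_GP = (sin 2πx₃, sin 2πx₁, sin 2πx₂)`, `f₁₂₃ = (sin 2πx₃, sin 4πx₁, sin 6πx₂)`): such a force meets
every coordinate cross `X_j`, so the dressed ray must run in a fully SKEW frame, and its unit modes are then
in the OSCILLATORY regime `|k_⊥| < |k| = 1 < |ξ|` of DRESSED-RAY-r1-3 §3.5. -/
def IsAxisSupportedPoly (f : 𝕋³ → E³) : Prop :=
  ∃ (S : Finset (Fin 3 → ℤ)) (c : (Fin 3 → ℤ) → EuclideanSpace ℂ (Fin 3)),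
    (∀ k ∈ S, ∃ i : Fin 3, ∀ j : Fin 3, j ≠ i → k j = 0) ∧ f = Torus.realTrigPoly S c

theorem IsAxisSupportedPoly.isTrigPolyForce {f : 𝕋³ → E³} (h : IsAxisSupportedPoly f) :
    IsTrigPolyForce f := by
  obtain ⟨S, c, -, rfl⟩ := h
  exact ⟨S, c, rfl⟩

/-- TARGET A (= `stub_skewFrameResponse` ∘ `stub_rayOfResponse` ∘ `stub_endgame` of
`Cruxes/KolmogorovFloor/Lines/dressed-laminar-ray.lean`, restricted to the class where crux #7 lives; supported
by this card's kit LSQ audit in the skew oscillatory frames ((1,1,0),(1,-1,1)) and ((0,1,1),(1,-1,1))):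
the Kolmogorov-class floor dies for every axis-supported polynomial force. -/
def AxisSupportedFloorKill : Prop :=
  ∀ f : 𝕋³ → E³, Torus.IsSmooth f → Torus.IsDivFree f → Torus.HasZeroMean f → IsAxisSupportedPoly f →
    FloorKillAtFor (3 / 4) f

/-- TARGET B (THEOREMS A + B of the dressed ray with the (Y2) frame lemma): every polynomial force. -/
def PolyFloorKill : Prop :=
  ∀ f : 𝕋³ → E³, Torus.IsSmooth f → Torus.IsDivFree f → Torus.HasZeroMean f → IsTrigPolyForce f →
    FloorKillAtFor (3 / 4) f

theorem axisSupportedFloorKill_of_poly (h : PolyFloorKill) : AxisSupportedFloorKill :=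
  fun f hs hd hz hax => h f hs hd hz hax.isTrigPolyForce

/-- Consequence for the crux: under TARGET A no witness of #7 is axis-supported — in particular neither of the
two ensemble-ceiling candidate forces on record can serve the same-force coupling. -/
theorem kfec_witness_not_axisSupported (hA : AxisSupportedFloorKill) (h : KolmogorovFloorEnsembleCeiling) :
    ∃ f : 𝕋³ → E³, Torus.IsSmooth f ∧ Torus.IsDivFree f ∧ Torus.HasZeroMean f ∧
      FloorClassAtFor (3 / 4) f ∧ CeilClassFor f ∧ ¬ IsAxisSupportedPoly f :=
  kfec_witness_outside (Killed := IsAxisSupportedPoly) (fun f hs hd hz hk => Or.inl (hA f hs hd hz hk)) h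

/-- … and under TARGET B any witness of #7 is a NON-polynomial smooth force (THEOREM C territory). -/
theorem kfec_witness_not_poly (hB : PolyFloorKill) (h : KolmogorovFloorEnsembleCeiling) :
    ∃ f : 𝕋³ → E³, Torus.IsSmooth f ∧ Torus.IsDivFree f ∧ Torus.HasZeroMean f ∧
      FloorClassAtFor (3 / 4) f ∧ CeilClassFor f ∧ ¬ IsTrigPolyForce f :=
  kfec_witness_outside (Killed := IsTrigPolyForce) (fun f hs hd hz hk => Or.inl (hB f hs hd hz hk)) h

end Summit.AnomalousDissipation.AnomalousDissipation.Cruxes.KolmogorovFloorEnsembleCeiling.Ideator1
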